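import Summits.BirchSwinnertonDyer.BirchSwinnertonDyer.Theorems.SignedLowerHalvesKobayashiLowerHalfSemistableDefmuTorsionImageKernels
import HarnessLib

/-!
# The image of the torsion `Δ` of `G̃_∞ = lim Pic(𝒪_{p^n})` in the finite layers: `Δ ↪ Pic(𝒪_{p^{n}})` for `n ≥ 1`
# (`p` odd), i.e. the restriction maps induce BIJECTIONS `torsionImage (n+2) → torsionImage (n+1)`

Route-independent `Theorems` file (cell `b2b-bsdres`, seat `b2b-bsdres-x10b` = class owner X6/X7, gen 43); part 2b of the
series «defmu / supersingular theta elements» serving crux 2 `KobayashiLowerHalfSemistable` (stmt-BirchSwinnertonDyer-19000).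
HONEST FRAMING: prove what is provable now; shrink each hard class to its core with data; no claim beyond stated classes.
Nothing about any curve is asserted and NO summit statement is proved here; BSD is not proved by any of this.

Darmon–Iovita (J. Inst. Math. Jussieu 7 (2008), §2.2) and Bertolini–Darmon (Ann. of Math. 162 (2005), §1.2) write
`G̃_∞ = Δ × G_∞` with `Δ` the (finite) torsion subgroup and `G_∞ ≃ ℤ_p`, and set `G_n := G̃_{n+1}/Δ` — implicitly: `Δ` maps
INJECTIVELY to every layer `G̃_{n+1} = Pic(𝒪_{p^{n+1}})`, `n ≥ 0`. The tree's `torsionImage K p n ⊆ Pic(𝒪_{p^n})` (file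
`GrossPointsThetaElement.lean`) is the image of `Δ` (classes with lifts of one bounded exponent to every higher layer) and
`AcLayerGroup K p n = Pic(𝒪_{p^n}) ⧸ torsionImage` are the anticyclotomic layer groups carrying `thetaAc`, `lAc`,
`HasMuZeroAc`, `HasMuZeroLAc`. NO structural fact about `torsionImage` was in the tree. Part 2a
`…DefmuTorsionImageKernels.lean` (§§1–4) and this file (§§5–8) prove, for `K` imaginary quadratic and `p` an ODD prime
(from Cox's description of the kernels `Pic(𝒪_{cp}) → Pic(𝒪_c)`, tree files `QuadOrderPicardTower` / `QuadOrderPicardCoprime`):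

* §1 `picRes_mem_torsionImage` — the restrictions map `torsionImage (m)` INTO `torsionImage (n)` (`n ≤ m`).
* §2 `pow_eq_one_of_picRes_eq_one`, `natCard_ker_picRes` — the kernel of `Pic(𝒪_{p^{m+2}}) → Pic(𝒪_{p^{m+1}})` has order
  `p`, hence is killed by `p`.
* §3 `exists_picRes_eq_one_and_pow_ne_one` — the kernel of the TWO-step map `Pic(𝒪_{p^{k+3}}) → Pic(𝒪_{p^{k+1}})` contains an
  element of order `p²`: the class of Cox's ideal `𝔞_v = v𝒪_{cp²} + p²𝒪_c`, `v = 1 + cω`, `c = p^{k+1}` (`kerUnitOf` of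
  `QuadOrderPicardCoprime` with `ℓ = p²`), whose `p`-th power is `𝔞_{v^p}` with `v^p = X + cpY₁ω`, `p ∤ Y₁` (`p` odd), and
  `𝔞_{v^p}` is not principal (`1 ∉ 𝔞_{v^p}` by comparing `ω`-coordinates). So that kernel (order `p²`) is CYCLIC.
* §4–5 `pow_prime_ne_one_of_picRes`, `pow_pow_ne_one_of_picRes` — order growth along the tower: an element of
  `ker(Pic(𝒪_{p^{k+2+j}}) → Pic(𝒪_{p^{k+1}}))` NOT in `ker(→ Pic(𝒪_{p^{k+2}}))` has `g^{p^j} ≠ 1`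
  (i.e. `ker(G̃_∞ → G̃_{k+1}) ≃ ℤ_p` is torsion-free; `1 + p𝒪_K ⊗ ℤ_p` has no torsion for `p` odd).
* §6 `eq_one_of_mem_torsionImage_of_picRes_eq_one` — **`Δ ∩ ker = 1`**: `torsionImage (k+2) ∩ ker(→ Pic(𝒪_{p^{k+1}})) = {1}`.
* §7 `exists_mem_torsionImage_picRes_eq` — **`Δ ↠ Δ`**: `torsionImage (n+1) → torsionImage (n)` is ONTO (compactness: a
  decreasing sequence of non-empty finite sets of lifts stabilises; every `n ≥ 0`, any prime).
* §8 `bijOn_picRes_torsionImage`, `sum_torsionImage_comp_picRes` — the restriction is a BIJECTION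
  `torsionImage (k+2) ≃ torsionImage (k+1)` and sums over `Δ`-cosets transport along it (the input of DI's relation (8)
  for the anticyclotomic elements `L_n`, part 3 of the series).

## References

* [DarmonIovita2008] H. Darmon, A. Iovita, J. Inst. Math. Jussieu 7 (2008), §2.2 ("`G̃_∞ = Δ × G_∞` … `G_n := G̃_{n+1}/Δ`").
* [BertoliniDarmon2005] M. Bertolini, H. Darmon, Ann. of Math. 162 (2005), §1.2 (18)–(21).
* [Cox2013] D. A. Cox, *Primes of the form x² + ny²*, 2nd ed., §7.D Thm. 7.24, (7.25)–(7.27) (the kernels, via the tree).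
-/

noncomputable section

open scoped BigOperators

-- D-0017: single-problem summit, the namespace repeats the problem name by design.
set_option linter.dupNamespace false

namespace Summit.BirchSwinnertonDyer.BirchSwinnertonDyer.Theorems.DefmuSupersingularTheta

open Literature.NumberTheory.EllipticCurves Literature.NumberTheory.EllipticCurves.QuadOrderTower
  Literature.NumberTheory.QuadraticFields.Quadratic NumberField Module

universe u

variable {K : Type u} [Field K] [NumberField K] (p : ℕ) [hp : Fact p.Prime]

/-! ### §5 Order growth along the tower: `ker(G̃_∞ → G̃_{k+1})` is torsion-free -/

/-- **Order growth**: an element of `ker(Pic(𝒪_{p^{M}}) → Pic(𝒪_{p^{k+1}}))`, `M = k + 2 + j`, which is NOT in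
`ker(→ Pic(𝒪_{p^{k+2}}))` satisfies `g^{p^j} ≠ 1` (so has order exactly `p^{j+1}`; the `j+1`-step kernel is cyclic).
Induction on `j`, replacing `g` by `g^p` and `k` by `k + 1` (§2, §4). [cite: DarmonIovita2008, §2.2] [cite: Cox2013, §7.D Thm. 7.24] -/
theorem pow_pow_ne_one_of_picRes (hK : IsImaginaryQuadratic K) (hp2 : p ≠ 2) (j : ℕ) :
    ∀ (k M : ℕ) (hM : M = k + 2 + j) (g : ClassGroup (quadOrder K (p ^ M))),
      picRes K (pow_dvd_pow p (by omega : k + 1 ≤ M)) g = 1 →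
      picRes K (pow_dvd_pow p (by omega : k + 2 ≤ M)) g ≠ 1 → g ^ p ^ j ≠ 1 := by
  induction j with
  | zero =>
    intro k M hM g _ h2 hg
    rw [pow_zero, pow_one] at hg
    exact h2 (by rw [hg, map_one])
  | succ j ih =>
    intro k M hM g h1 h2 hgp
    rw [pow_succ', pow_mul] at hgp
    have hM' : M = (k + 1) + 2 + j := by omega
    refine ih (k + 1) M hM' (g ^ p) ?_ ?_ hgp
    · rw [map_pow]
      apply pow_eq_one_of_picRes_eq_one p hK k
      rw [picRes_picRes]; exact h1
    · rw [map_pow]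
      apply pow_prime_ne_one_of_picRes p hK hp2 k
      · rw [picRes_picRes]; exact h1
      · rw [picRes_picRes]; exact h2

/-! ### §6 `Δ ∩ ker = 1`: `torsionImage` meets the one-step kernels trivially above level `1` -/

/-- **`Δ ↪ G̃_{k+1}`**: a class of `torsionImage (k+2)` restricting to `1` in `Pic(𝒪_{p^{k+1}})` is `1` (`K` imaginary
quadratic, `p` odd). If `κ ≠ 1` had lifts of one exponent `e = p^a e'` (`p ∤ e'`) to every layer, the `e'`-th power of a
lift to layer `k + 2 + a` would contradict the order growth of §5. This is the implicit content of Darmon–Iovita's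
"`G_n := G̃_{n+1}/Δ`" (`Δ` maps isomorphically to the layers `n + 1 ≥ 1`). [cite: DarmonIovita2008, §2.2]
[cite: BertoliniDarmon2005, §1.2 (21)] -/
theorem eq_one_of_mem_torsionImage_of_picRes_eq_one (hK : IsImaginaryQuadratic K) (hp2 : p ≠ 2) (k : ℕ)
    {κ : ClassGroup (quadOrder K (p ^ (k + 2)))} (hκ : κ ∈ torsionImage K p (k + 2))
    (h1 : picRes K (pow_dvd_pow p (k + 1).le_succ) κ = 1) : κ = 1 := by
  by_contra hne
  obtain ⟨e, he, hlift⟩ := hκ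
  obtain ⟨a, e', he', rfl⟩ := Nat.exists_eq_pow_mul_and_not_dvd he.ne' p hp.out.ne_one
  obtain ⟨g', hg'e, hg'⟩ := hlift (k + 2 + a) (by omega)
  have hκp : κ ^ p = 1 := pow_eq_one_of_picRes_eq_one p hK k h1
  have hκe' : κ ^ e' ≠ 1 := by
    intro h
    have hdvd : orderOf κ ∣ Nat.gcd e' p :=
      Nat.dvd_gcd (orderOf_dvd_of_pow_eq_one h) (orderOf_dvd_of_pow_eq_one hκp)
    have hcop : Nat.Coprime e' p := (Nat.coprime_comm.mp (hp.out.coprime_iff_not_dvd.mpr he'))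
    rw [hcop] at hdvd
    exact hne (orderOf_eq_one_iff.mp (Nat.dvd_one.mp hdvd))
  have H1 : picRes K (pow_dvd_pow p (by omega : k + 1 ≤ k + 2 + a)) (g' ^ e') = 1 := by
    have h : picRes K (pow_dvd_pow p (k + 1).le_succ)
        (picRes K (pow_dvd_pow p (by omega : k + 2 ≤ k + 2 + a)) (g' ^ e')) = 1 := by
      rw [map_pow, hg', map_pow, h1, one_pow]
    rwa [picRes_picRes] at h
  have H2 : picRes K (pow_dvd_pow p (by omega : k + 2 ≤ k + 2 + a)) (g' ^ e') ≠ 1 := by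
    rw [map_pow, hg']; exact hκe'
  have H3 : (g' ^ e') ^ p ^ a = 1 := by rw [← pow_mul, mul_comm, hg'e]
  exact pow_pow_ne_one_of_picRes p hK hp2 a k (k + 2 + a) rfl (g' ^ e') H1 H2 H3

/-! ### §7 `Δ ↠ Δ`: the restriction `torsionImage (n+1) → torsionImage (n)` is onto -/

omit hp in
/-- **`torsionImage (n+1) → torsionImage (n)` is ONTO** (every `n ≥ 0`, every `p`): for `g` with lifts of exponent `e`
to all layers, the images in `Pic(𝒪_{p^{n+1}})` of the exponent-`e` lifts of `g` to layer `n + 1 + i` form a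
DECREASING sequence of non-empty finite sets, which stabilises (finiteness of `Pic`, Neukirch I (12.12) =
`QuadOrderTower.finite_classGroup`); a point of the stable set lies in `torsionImage (n+1)` over `g`. (Compactness of
`G̃_∞ = lim Pic(𝒪_{p^n})`: "by compactness this is exactly the image of `Δ`" — docstring of `torsionImage`.)
[cite: BertoliniDarmon2005, §1.2 (21)] [cite: DarmonIovita2008, §2.2] -/
theorem exists_mem_torsionImage_picRes_eq [NeZero p] (n : ℕ) {g : ClassGroup (quadOrder K (p ^ n))}
    (hg : g ∈ torsionImage K p n) :
    ∃ h ∈ torsionImage K p (n + 1), picRes K (pow_dvd_pow p n.le_succ) h = g := by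
  obtain ⟨e, he, hlift⟩ := hg
  haveI : Finite (ClassGroup (quadOrder K (p ^ (n + 1)))) := finite_classGroup (K := K) _
  let A : ℕ → Set (ClassGroup (quadOrder K (p ^ (n + 1)))) := fun i =>
    {y | ∃ x : ClassGroup (quadOrder K (p ^ (n + 1 + i))),
      x ^ e = 1 ∧ picRes K (pow_dvd_pow p (by omega : n ≤ n + 1 + i)) x = g ∧
        picRes K (pow_dvd_pow p (by omega : n + 1 ≤ n + 1 + i)) x = y}
  have hA : ∀ i y, y ∈ A i ↔ ∃ x : ClassGroup (quadOrder K (p ^ (n + 1 + i))),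
      x ^ e = 1 ∧ picRes K (pow_dvd_pow p (by omega : n ≤ n + 1 + i)) x = g ∧
        picRes K (pow_dvd_pow p (by omega : n + 1 ≤ n + 1 + i)) x = y := fun i y => Iff.rfl
  have hne : ∀ i, (A i).Nonempty := fun i => by
    obtain ⟨x, hxe, hx⟩ := hlift (n + 1 + i) (by omega)
    exact ⟨_, (hA i _).mpr ⟨x, hxe, hx, rfl⟩⟩
  have hanti : ∀ i, A (i + 1) ⊆ A i := fun i y hy => by
    obtain ⟨x, hxe, hxg, hxy⟩ := (hA (i + 1) y).mp hy
    refine (hA i y).mpr ⟨picRes K (pow_dvd_pow p (by omega : n + 1 + i ≤ n + 1 + (i + 1))) x,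
      by rw [← map_pow, hxe, map_one], ?_, ?_⟩
    · rw [picRes_picRes]; exact hxg
    · rw [picRes_picRes]; exact hxy
  have hanti' : ∀ i j, i ≤ j → A j ⊆ A i := fun i j hij => by
    induction hij with
    | refl => exact subset_rfl
    | step _ ih => exact (hanti _).trans ih
  -- a layer of minimal cardinality; the sequence is constant from there on
  let i₀ := Function.argmin (fun i => (A i).ncard)
  have hmin : ∀ i, (A i₀).ncard ≤ (A i).ncard := fun i => Function.argmin_le (fun i => (A i).ncard) i
  have hsub : ∀ i, A i₀ ⊆ A i := fun i => by
    rcases le_total i i₀ with h | h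
    · exact hanti' i i₀ h
    · exact (Set.eq_of_subset_of_ncard_le (hanti' i₀ i h) (hmin i) (Set.toFinite _)).symm.subset
  obtain ⟨y, hy⟩ := hne i₀
  refine ⟨y, ⟨e, he, fun M hM => ?_⟩, ?_⟩
  · obtain ⟨i, rfl⟩ := Nat.exists_eq_add_of_le hM
    obtain ⟨x, hxe, -, hxy⟩ := (hA i y).mp (hsub i hy)
    exact ⟨x, hxe, hxy⟩
  · obtain ⟨x, -, hxg, hxy⟩ := (hA 0 y).mp (hsub 0 hy)
    rw [← hxy, picRes_picRes]
    exact hxg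

/-! ### §8 The bijection `torsionImage (k+2) ≃ torsionImage (k+1)` and transport of `Δ`-sums -/

/-- **`Δ ≅ Δ` in the layers `≥ 1`**: for `K` imaginary quadratic and `p` odd, the restriction
`Pic(𝒪_{p^{k+2}}) → Pic(𝒪_{p^{k+1}})` maps `torsionImage (k+2)` BIJECTIVELY onto `torsionImage (k+1)` — the finite layers
of "`G̃_∞ = Δ × G_∞`, `G_n = G̃_{n+1}/Δ`". [cite: DarmonIovita2008, §2.2] [cite: BertoliniDarmon2005, §1.2 (18)–(21)] -/
theorem bijOn_picRes_torsionImage (hK : IsImaginaryQuadratic K) (hp2 : p ≠ 2) (k : ℕ) :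
    Set.BijOn (picRes K (pow_dvd_pow p (k + 1).le_succ))
      (torsionImage K p (k + 2) : Set (ClassGroup (quadOrder K (p ^ (k + 2)))))
      (torsionImage K p (k + 1) : Set (ClassGroup (quadOrder K (p ^ (k + 1))))) := by
  haveI : NeZero p := ⟨hp.out.ne_zero⟩
  refine ⟨fun g hg => picRes_mem_torsionImage p (k + 1).le_succ hg, fun g₁ hg₁ g₂ hg₂ heq => ?_,
    fun g hg => ?_⟩
  · have hmem : g₁ * g₂⁻¹ ∈ torsionImage K p (k + 2) := Subgroup.mul_mem _ hg₁ (Subgroup.inv_mem _ hg₂)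
    have h1 : picRes K (pow_dvd_pow p (k + 1).le_succ) (g₁ * g₂⁻¹) = 1 := by
      rw [map_mul, map_inv, heq, mul_inv_cancel]
    exact mul_inv_eq_one.mp (eq_one_of_mem_torsionImage_of_picRes_eq_one p hK hp2 k hmem h1)
  · obtain ⟨h, hh, hhg⟩ := exists_mem_torsionImage_picRes_eq p (k + 1) hg
    exact ⟨h, hh, hhg⟩

/-- **Transport of `Δ`-sums**: `Σ_{δ ∈ Δ_{k+2}} F(δ̄) = Σ_{δ' ∈ Δ_{k+1}} F(δ')` along the bijection of
`bijOn_picRes_torsionImage` (the step turning the `Δ`-coset sums of the norm relation at layer `k + 2` into the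
coefficients of `L_{k}` — Darmon–Iovita (8)). [cite: DarmonIovita2008, §2.2 (8)] -/
theorem sum_torsionImage_comp_picRes (hK : IsImaginaryQuadratic K) (hp2 : p ≠ 2) (k : ℕ) {M : Type*}
    [AddCommMonoid M] [Fintype (ClassGroup (quadOrder K (p ^ (k + 2))))]
    [Fintype (ClassGroup (quadOrder K (p ^ (k + 1))))]
    [DecidablePred (· ∈ torsionImage K p (k + 2))] [DecidablePred (· ∈ torsionImage K p (k + 1))]
    (F : ClassGroup (quadOrder K (p ^ (k + 1))) → M) :
    ∑ δ ∈ Finset.univ.filter (· ∈ torsionImage K p (k + 2)), F (picRes K (pow_dvd_pow p (k + 1).le_succ) δ) =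
      ∑ δ' ∈ Finset.univ.filter (· ∈ torsionImage K p (k + 1)), F δ' := by
  have hbij := bijOn_picRes_torsionImage p hK hp2 k
  refine Finset.sum_nbij (picRes K (pow_dvd_pow p (k + 1).le_succ)) (fun δ hδ => ?_) (fun δ₁ hδ₁ δ₂ hδ₂ h => ?_)
    (fun δ' hδ' => ?_) (fun _ _ => rfl)
  · simp only [Finset.mem_filter, Finset.mem_univ, true_and] at hδ ⊢
    exact hbij.mapsTo hδ
  · simp only [Finset.coe_filter, Finset.mem_univ, true_and, Set.mem_setOf_eq] at hδ₁ hδ₂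
    exact hbij.injOn hδ₁ hδ₂ h
  · simp only [Finset.coe_filter, Finset.mem_univ, true_and, Set.mem_setOf_eq, Set.mem_image] at hδ' ⊢
    obtain ⟨δ, hδ, rfl⟩ := hbij.surjOn hδ'
    exact ⟨δ, hδ, rfl⟩
end Summit.BirchSwinnertonDyer.BirchSwinnertonDyer.Theorems.DefmuSupersingularTheta

end
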